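import Summits.RiemannHypothesis.RiemannHypothesis.Theorems.PfPersistencePerronFakeNodelessSmallWindow
import Summits.RiemannHypothesis.RiemannHypothesis.Theorems.GroundBartaPolarPerronFrobeniusEvenThreshold
import HarnessLib

/-!
# PF persistence — PERRON-FAKE (S6), part 5a: the EVEN-SECTOR archimedean channel
# (symmetrised kernel bound `ρ(a)·(∫u⁺)(∫u⁻)` for even members of the window class; numerics to `11/40`)

`pub-rhpf` cell, unit `pub-rhpf-prover-perron` (S6; CASE-DAG §6 row PERRON-FAKE; leaves G1.01 / G1.02,
FAKE column).  **Mechanism / rigidity campaign; no RH claims.**  RH-free, definition-free: Mathlib +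
proved tree files only.  Tools for part 5b (`…EvenWindow.lean`).

Part 4 bounded the archimedean part of the lobe-balance law from below by `ρ(2a)·(∫u⁺)(∫u⁻)`
(`ρ = weilArchDensity`; `ρ(t) ≥ ρ(2a)` wherever `u⁻(x)u⁺(x ± t)` lives).  For an EVEN `u` the
attraction felt at `x` from the positive lobe comes from both `y` and `−y`, i.e. through the
symmetrised kernel `½(ρ|x−y| + ρ|x+y|) ≥ ρ((|x−y| + |x+y|)/2) ≥ ρ(a)` (midpoint convexity and
monotonicity of `ρ` on `(0,∞)`, the tree's `swe_weilArchDensity_midpoint` / `weilArchDensity_antitoneOn`;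
`|x−y| + |x+y| = 2max(|x|,|y|) ≤ 2a`):

* `archPairing_ge_of_even` (PROVED): for a real even `u ∈ L²` supported in `[-a,a]` with finite
  archimedean energies of `u` and `|u|`,
  `ρ(a)·(∫u⁺)(∫u⁻) ≤ ∫ u⁻(y) ∫_{t>0} ρ(t)(u⁺(y+t) + u⁺(y−t)) dt dy`.
  Proof: compare `ρ` on `(0,∞)` with its bounded even truncation `κ = min(ρ(|·|), 2ρ(a))` against the
  nonnegative gain (finite energy gives integrability on the `t` side), Tonelli on
  `κ(t)u⁻(x)u⁺(x ± t)` over `(0,∞) × ℝ`, translate to the `y`-convolution `∫κ(x−y)u⁺(y)dy`, reflect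
  (`u⁺` even) to `½∫(κ(x−y) + κ(x+y))u⁺(y)dy`, and use the pair bound
  `two_mul_weilArchDensity_le_truncPair`: `κ(x−y) + κ(x+y) ≥ 2ρ(a)` for `x, y ∈ [-a,a]` off the two
  diagonals (a null set for each `x`).
* `one_add_cosh_lt_weilArchDensity_of_le` (PROVED numerics, from the tree's `et_one_add_cosh_le`,
  `et_weilArchDensity_ge`): `0 < a ≤ 11/40 ⇒ 1 + cosh a < ρ(a)` (`2.0382 < 2.05`; true threshold
  `a = 0.2782…`); `two_mul_lt_log_two_of_le_evenWindow`: `a ≤ 11/40 ⇒ 2a < log 2`.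

Scope (honest): pure real analysis of the archimedean density shared by every table; no table, no
prime and no RH content enters this file.

References (mechanism only): E. Bombieri, Rend. Mat. Acc. Lincei (9) 11 (2000) 183–233, Thm 2 (the
archimedean density `ρ(t) = e^{t/2}/(2 sinh t)` of the windowed form); M. Reed, B. Simon, *Methods of
Modern Mathematical Physics IV* (1978) §XIII.12 (positivity of kernels and nodeless ground states).
-/

set_option linter.dupNamespace false

noncomputable section

open MeasureTheory Set Filter Complex
open scoped Real Topology

namespace Summit.RiemannHypothesis.RiemannHypothesis.Theorems.PfPersistence

open Literature.NumberTheory.LFunctions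
open Summit.RiemannHypothesis.RiemannHypothesis.Theorems.WeilGroundStateMarkovPart
open Summit.RiemannHypothesis.RiemannHypothesis.Theorems.PolarPerronFrobenius

section EvenKernelTools

variable {a : ℝ} {u : ℝ → ℝ}

/-! ### Bounded even kernels against integrable functions -/

/-- A measurable kernel bounded by `C`, times an integrable function, is integrable. [folklore] -/
theorem integrable_kernel_mul {μ : Measure ℝ} {κ g : ℝ → ℝ} {C : ℝ} (hg : Integrable g μ)
    (hκm : Measurable κ) (hκb : ∀ s, |κ s| ≤ C) : Integrable (fun s ↦ κ s * g s) μ :=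
  hg.bdd_mul hκm.aestronglyMeasurable (Eventually.of_forall fun s ↦ by
    rw [Real.norm_eq_abs]; exact hκb s)

/-- `∫_{t>0} κ(t)(v(x+t) + v(x−t)) dt = ∫ κ(x−s) v(s) ds` for an integrable `v` and a bounded
measurable even kernel `κ`. [folklore] -/
theorem integral_Ioi_kernel_add_sub_eq {v κ : ℝ → ℝ} {C : ℝ} (hv : Integrable v)
    (hκm : Measurable κ) (hκb : ∀ s, |κ s| ≤ C) (hκe : ∀ s, κ (-s) = κ s) (x : ℝ) :
    ∫ t in Ioi (0 : ℝ), κ t * (v (x + t) + v (x - t)) = ∫ s, κ (x - s) * v s := by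
  have hg : Integrable fun s ↦ κ (x - s) * v s :=
    integrable_kernel_mul hv (hκm.comp (measurable_const.sub measurable_id)) (fun s ↦ hκb _)
  have h1 : ∫ t in Ioi (0 : ℝ), κ t * v (x + t) = ∫ s in Ioi x, κ (x - s) * v s := by
    have hmp : MeasurePreserving (fun t : ℝ ↦ x + t) volume volume :=
      measurePreserving_add_left volume x
    have hme : MeasurableEmbedding (fun t : ℝ ↦ x + t) := measurableEmbedding_addLeft x
    have h := hmp.setIntegral_preimage_emb hme (fun s ↦ κ (x - s) * v s) (Ioi x)
    rw [Set.preimage_const_add_Ioi, sub_self] at h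
    rw [← h]
    refine setIntegral_congr_fun measurableSet_Ioi fun t _ ↦ ?_
    rw [show x - (x + t) = -t by ring, hκe]
  have h2 : ∫ t in Ioi (0 : ℝ), κ t * v (x - t) = ∫ s in Iio x, κ (x - s) * v s := by
    have hmp : MeasurePreserving (fun t : ℝ ↦ x - t) volume volume :=
      Measure.measurePreserving_sub_left volume x
    have hme : MeasurableEmbedding (fun t : ℝ ↦ x - t) := measurableEmbedding_subLeft x
    have h := hmp.setIntegral_preimage_emb hme (fun s ↦ κ (x - s) * v s) (Iio x)
    rw [Set.preimage_const_sub_Iio, sub_self] at h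
    rw [← h]
    refine setIntegral_congr_fun measurableSet_Ioi fun t _ ↦ ?_
    rw [show x - (x - t) = t by ring]
  have hi1 : IntegrableOn (fun t ↦ κ t * v (x + t)) (Ioi 0) :=
    (integrable_kernel_mul (hv.comp_add_left x) hκm hκb).integrableOn
  have hi2 : IntegrableOn (fun t ↦ κ t * v (x - t)) (Ioi 0) :=
    (integrable_kernel_mul (hv.comp_sub_left x) hκm hκb).integrableOn
  have e : (fun t ↦ κ t * (v (x + t) + v (x - t))) =
      fun t ↦ κ t * v (x + t) + κ t * v (x - t) := by
    funext t; ring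
  rw [e, integral_add hi1 hi2, h1, h2, add_comm, ← integral_Iic_eq_integral_Iio,
    intervalIntegral.integral_Iic_add_Ioi hg.integrableOn hg.integrableOn]

/-- Reflection for an even `v`: `∫ κ(x−s) v(s) ds = ∫ κ(x+s) v(s) ds`. [folklore] -/
theorem integral_kernel_sub_eq_add {v κ : ℝ → ℝ} (hve : ∀ s, v (-s) = v s) (x : ℝ) :
    ∫ s, κ (x - s) * v s = ∫ s, κ (x + s) * v s := by
  rw [← integral_neg_eq_self (fun s ↦ κ (x - s) * v s) volume]
  refine integral_congr_ae (Eventually.of_forall fun s ↦ ?_)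
  simp only [sub_neg_eq_add, hve]

/-! ### The symmetrised truncated kernel at a pair of points of the window -/

/-- **Pair bound.**  For `x, s ∈ [-a, a]` off the two diagonals,
`min(ρ|x−s|, 2ρ(a)) + min(ρ|x+s|, 2ρ(a)) ≥ 2ρ(a)` (`|x−s| + |x+s| ≤ 2a`, midpoint convexity
`2ρ((p+q)/2) ≤ ρ(p) + ρ(q)` and monotonicity of `ρ` on `(0, ∞)`). [folklore] -/
theorem two_mul_weilArchDensity_le_truncPair (ha0 : 0 < a) {x s : ℝ} (hx : x ∈ Icc (-a) a)
    (hs : s ∈ Icc (-a) a) (h1 : s ≠ x) (h2 : s ≠ -x) :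
    2 * weilArchDensity a ≤ min (weilArchDensity |x - s|) (2 * weilArchDensity a) +
      min (weilArchDensity |x + s|) (2 * weilArchDensity a) := by
  have hwa : 0 < weilArchDensity a := weilArchDensity_pos ha0
  have hp : 0 < |x - s| := abs_pos.2 (sub_ne_zero.2 (Ne.symm h1))
  have hq : 0 < |x + s| := abs_pos.2 fun h ↦ h2 (by linarith)
  have hpq : |x - s| + |x + s| ≤ 2 * a :=
    swe_abs_sub_add_abs_add_le (abs_le.2 ⟨hx.1, hx.2⟩) (abs_le.2 ⟨hs.1, hs.2⟩)
  have hwp : 0 < weilArchDensity |x - s| := weilArchDensity_pos hp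
  have hwq : 0 < weilArchDensity |x + s| := weilArchDensity_pos hq
  have hmid := swe_weilArchDensity_midpoint hp hq
  have hm0 : 0 < (|x - s| + |x + s|) / 2 := by linarith
  have hanti : weilArchDensity a ≤ weilArchDensity ((|x - s| + |x + s|) / 2) :=
    weilArchDensity_antitoneOn (mem_Ioi.2 hm0) (mem_Ioi.2 ha0) (by linarith)
  by_cases hpM : weilArchDensity |x - s| ≤ 2 * weilArchDensity a
  · by_cases hqM : weilArchDensity |x + s| ≤ 2 * weilArchDensity a
    · rw [min_eq_left hpM, min_eq_left hqM]; linarith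
    · rw [min_eq_left hpM, min_eq_right (not_le.1 hqM).le]; linarith
  · rw [min_eq_right (not_le.1 hpM).le]
    have : 0 ≤ min (weilArchDensity |x + s|) (2 * weilArchDensity a) := le_min hwq.le (by linarith)
    linarith

/-! ### The even archimedean channel -/

/-- **Even archimedean channel (PROVED).**  For a real even `u ∈ L²(ℝ)` supported in `[-a, a]`
(`0 < a`) whose archimedean energies and those of `|u|` are finite,
`ρ(a)·(∫u⁺)(∫u⁻) ≤ ∫ u⁻(y) ∫_{t>0} ρ(t)(u⁺(y+t) + u⁺(y−t)) dt dy`. [folklore] -/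
theorem archPairing_ge_of_even (hum : Measurable u) (hu2 : MemLp u 2 volume)
    (hus' : ∀ x : ℝ, x ∉ Icc (-a) a → u x = 0) (he : ∀ x, u (-x) = u x) (ha0 : 0 < a)
    (hE : IntegrableOn (fun t ↦ weilArchDensity t * weilIncrement (fun x ↦ ((u x : ℝ) : ℂ)) t) (Ioi 0))
    (hEA : IntegrableOn
      (fun t ↦ weilArchDensity t * weilIncrement (fun x ↦ ((|u x| : ℝ) : ℂ)) t) (Ioi 0)) :
    weilArchDensity a * ((∫ x, max (u x) 0) * ∫ x, max (-u x) 0) ≤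
      ∫ y, max (-u y) 0 *
        ∫ t in Ioi (0 : ℝ), weilArchDensity t * (max (u (y + t)) 0 + max (u (y - t)) 0) := by
  have hus : ∀ᵐ x : ℝ, x ∉ Icc (-a) a → u x = 0 := Eventually.of_forall hus'
  have hpe : ∀ x, max (u (-x)) 0 = max (u x) 0 := fun x ↦ by rw [he]
  have hp1 : Integrable fun x ↦ max (u x) 0 :=
    swg_integrable_of_memLp (swg_memLp_posPart hu2) (swg_posPart_ae_zero hus)
  have hn1 : Integrable fun x ↦ max (-u x) 0 :=
    swg_integrable_of_memLp (swg_memLp_negPart hu2) (swg_negPart_ae_zero hus)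
  obtain ⟨harch, -⟩ := swg_archGain_eq hum hu2 hE hEA
  -- the integrand on `(t, x)` (as in part 4)
  set F : ℝ × ℝ → ℝ := fun q ↦ max (-u q.2) 0 * (max (u (q.2 + q.1)) 0 + max (u (q.2 - q.1)) 0)
    with hF
  have hpm : Measurable fun x ↦ max (u x) 0 := hum.max measurable_const
  have hnm : Measurable fun x ↦ max (-u x) 0 := hum.neg.max measurable_const
  have hFm : Measurable F :=
    (hnm.comp measurable_snd).mul
      ((hpm.comp (measurable_snd.add measurable_fst)).add (hpm.comp (measurable_snd.sub measurable_fst)))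
  have hF0 : ∀ q, 0 ≤ F q := fun q ↦
    mul_nonneg (le_max_right _ _) (add_nonneg (le_max_right _ _) (le_max_right _ _))
  have hfib : ∀ x, Integrable (fun t ↦ F (t, x)) (volume.restrict (Ioi 0)) := fun x ↦
    (((hp1.comp_add_left x).add (hp1.comp_sub_left x)).const_mul (max (-u x) 0)).restrict
  have hfibint : ∀ x, ∫ t in Ioi (0 : ℝ), F (t, x) = max (-u x) 0 * ∫ s, max (u s) 0 := by
    intro x
    simp only [hF]
    rw [integral_const_mul, integral_Ioi_add_sub_eq hp1 x]
  have hFint : Integrable F ((volume.restrict (Ioi (0 : ℝ))).prod volume) := by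
    refine (integrable_prod_iff' hFm.aestronglyMeasurable).2 ⟨Eventually.of_forall hfib, ?_⟩
    have e : (fun x ↦ ∫ t in Ioi (0 : ℝ), ‖F (t, x)‖) = fun x ↦ max (-u x) 0 * ∫ s, max (u s) 0 := by
      funext x
      rw [← hfibint x]
      exact integral_congr_ae (Eventually.of_forall fun t ↦ Real.norm_of_nonneg (hF0 _))
    rw [e]
    exact hn1.mul_const _
  have hGint : Integrable (fun t ↦ ∫ x, F (t, x)) (volume.restrict (Ioi 0)) :=
    hFint.integral_prod_left
  have hG : ∀ t, weilIncrement (fun x ↦ ((u x : ℝ) : ℂ)) t -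
      weilIncrement (fun x ↦ ((|u x| : ℝ) : ℂ)) t = 4 * ∫ x, F (t, x) := by
    intro t
    rw [swg_weilIncrement_sub_abs hu2 t]
  -- the bounded even truncation `κ = min(ρ(|·|), 2ρ(a))` of the archimedean density
  have hwa : 0 < weilArchDensity a := weilArchDensity_pos ha0
  set κ : ℝ → ℝ := fun s ↦ min (weilArchDensity |s|) (2 * weilArchDensity a) with hκ
  have hκm : Measurable κ := (measurable_weilArchDensity.comp measurable_abs).min measurable_const
  have hκ0 : ∀ s, 0 ≤ κ s := by
    intro s
    simp only [hκ]
    rcases eq_or_ne s 0 with h | h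
    · subst h
      have h0 : weilArchDensity 0 = 0 := by simp [weilArchDensity]
      rw [abs_zero, h0]
      exact le_min le_rfl (by linarith)
    · exact le_min (weilArchDensity_pos (abs_pos.2 h)).le (by linarith)
  have hκM : ∀ s, |κ s| ≤ 2 * weilArchDensity a := fun s ↦ by
    rw [abs_of_nonneg (hκ0 s)]
    exact min_le_right _ _
  have hκe : ∀ s, κ (-s) = κ s := fun s ↦ by simp only [hκ, abs_neg]
  have hκw : ∀ t, 0 < t → κ t ≤ weilArchDensity t := fun t ht ↦ by
    simp only [hκ, abs_of_pos ht]
    exact min_le_left _ _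
  -- the `y`-convolution `W(x) = ∫ κ(x−s) u⁺(s) ds` and the `x`-fibres of `κ(t)F(t,x)`
  set W : ℝ → ℝ := fun x ↦ ∫ s, κ (x - s) * max (u s) 0 with hW
  have hfibW : ∀ x, ∫ t in Ioi (0 : ℝ), κ t * F (t, x) = max (-u x) 0 * W x := by
    intro x
    simp only [hF, hW]
    have e : (fun t ↦ κ t * (max (-u x) 0 * (max (u (x + t)) 0 + max (u (x - t)) 0))) =
        fun t ↦ max (-u x) 0 * (κ t * (max (u (x + t)) 0 + max (u (x - t)) 0)) := by
      funext t; ring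
    rw [e, integral_const_mul, integral_Ioi_kernel_add_sub_eq hp1 hκm hκM hκe x]
  -- `W ≥ ρ(a)·m₊` on the window (reflection + the pair bound, a.e. off the two diagonals)
  have hWge : ∀ x ∈ Icc (-a) a, weilArchDensity a * (∫ s, max (u s) 0) ≤ W x := by
    intro x hx
    have i1 : Integrable fun s ↦ κ (x - s) * max (u s) 0 :=
      integrable_kernel_mul hp1 (hκm.comp (measurable_const.sub measurable_id)) (fun s ↦ hκM _)
    have i2 : Integrable fun s ↦ κ (x + s) * max (u s) 0 :=
      integrable_kernel_mul hp1 (hκm.comp (measurable_const.add measurable_id)) (fun s ↦ hκM _)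
    have i12 : Integrable fun s ↦ (κ (x - s) + κ (x + s)) * max (u s) 0 :=
      (i1.add i2).congr (Eventually.of_forall fun s ↦ by simp only [Pi.add_apply]; ring)
    have hrefl : ∫ s, κ (x - s) * max (u s) 0 = ∫ s, κ (x + s) * max (u s) 0 :=
      integral_kernel_sub_eq_add hpe x
    have h2W : 2 * W x = ∫ s, (κ (x - s) + κ (x + s)) * max (u s) 0 := by
      have e : ∫ s, (κ (x - s) + κ (x + s)) * max (u s) 0 =
          (∫ s, κ (x - s) * max (u s) 0) + ∫ s, κ (x + s) * max (u s) 0 := by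
        rw [← integral_add i1 i2]
        exact integral_congr_ae (Eventually.of_forall fun s ↦ by simp only; ring)
      rw [e, ← hrefl]
      simp only [hW]
      ring
    have hnull : ∀ᵐ s : ℝ, s ≠ x ∧ s ≠ -x := by
      rw [ae_iff]
      have hsub : {s : ℝ | ¬(s ≠ x ∧ s ≠ -x)} ⊆ {x, -x} := by
        intro s hs
        simp only [mem_setOf_eq, not_and_or, not_not] at hs
        rcases hs with h | h
        · simp [h]
        · simp [h]
      exact measure_mono_null hsub (((Set.finite_singleton (-x)).insert x).measure_zero volume)
    have hWpt : ∀ᵐ s : ℝ, (2 * weilArchDensity a) * max (u s) 0 ≤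
        (κ (x - s) + κ (x + s)) * max (u s) 0 := by
      filter_upwards [hnull] with s hs
      by_cases hsI : s ∈ Icc (-a) a
      · exact mul_le_mul_of_nonneg_right
          (two_mul_weilArchDensity_le_truncPair ha0 hx hsI hs.1 hs.2) (le_max_right _ _)
      · rw [show max (u s) 0 = 0 by rw [hus' s hsI, max_self], mul_zero, mul_zero]
    have hI := integral_mono_ae (hp1.const_mul (2 * weilArchDensity a)) i12 hWpt
    rw [integral_const_mul] at hI
    linarith
  -- the weighted integrand `Ψ(t, x) = κ(t) F(t, x)` is integrable on `(0,∞) × ℝ`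
  set Ψ : ℝ × ℝ → ℝ := fun q ↦ κ q.1 * F q with hΨ
  have hΨm : Measurable Ψ := (hκm.comp measurable_fst).mul hFm
  have hΨint : Integrable Ψ ((volume.restrict (Ioi (0 : ℝ))).prod volume) := by
    refine Integrable.mono' (hFint.norm.const_mul (2 * weilArchDensity a)) hΨm.aestronglyMeasurable
      (Eventually.of_forall fun q ↦ ?_)
    simp only [hΨ]
    rw [norm_mul, Real.norm_eq_abs, Real.norm_eq_abs]
    exact mul_le_mul_of_nonneg_right (hκM _) (abs_nonneg _)
  have hΨx : Integrable (fun x ↦ max (-u x) 0 * W x) := by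
    have h := hΨint.swap.integral_prod_left
    refine h.congr (Eventually.of_forall fun x ↦ ?_)
    simp only [Function.comp_apply, Prod.swap_prod_mk, hΨ]
    exact hfibW x
  -- comparison at the level of `t`: `ρ(t) ≥ κ(t)` against the nonnegative gain `4∫F(t,·)`
  have hlow : ∫ t in Ioi (0 : ℝ), κ t * (4 * ∫ x, F (t, x)) ≤
      ∫ t in Ioi (0 : ℝ), weilArchDensity t * (weilIncrement (fun x ↦ ((u x : ℝ) : ℂ)) t -
        weilIncrement (fun x ↦ ((|u x| : ℝ) : ℂ)) t) := by
    refine setIntegral_mono_on (integrable_kernel_mul (hGint.const_mul 4) hκm hκM)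
      ((hE.sub hEA).congr (Eventually.of_forall fun t ↦ (mul_sub _ _ _).symm)) measurableSet_Ioi
      fun t ht ↦ ?_
    have ht0 : 0 < t := ht
    rw [hG t]
    exact mul_le_mul_of_nonneg_right (hκw t ht0)
      (mul_nonneg (by norm_num) (integral_nonneg fun x ↦ hF0 _))
  -- Tonelli: `∫_{t>0} κ(t)·4∫F(t,x)dx dt = 4∫ u⁻(x) W(x) dx`
  have hval : ∫ t in Ioi (0 : ℝ), κ t * (4 * ∫ x, F (t, x)) = 4 * ∫ x, max (-u x) 0 * W x := by
    have e1 : (fun t ↦ κ t * (4 * ∫ x, F (t, x))) = fun t ↦ 4 * ∫ x, Ψ (t, x) := by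
      funext t
      simp only [hΨ]
      rw [integral_const_mul]
      ring
    rw [e1, integral_const_mul]
    congr 1
    have hsw := integral_integral_swap (μ := volume.restrict (Ioi (0 : ℝ))) (ν := volume)
      (f := fun t x ↦ Ψ (t, x)) hΨint
    rw [hsw]
    exact integral_congr_ae (Eventually.of_forall fun x ↦ hfibW x)
  -- conclude
  have hWint : ∫ x, max (-u x) 0 * (weilArchDensity a * ∫ s, max (u s) 0) ≤
      ∫ x, max (-u x) 0 * W x := by
    refine integral_mono (hn1.mul_const _) hΨx fun x ↦ ?_
    by_cases hx : x ∈ Icc (-a) a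
    · exact mul_le_mul_of_nonneg_left (hWge x hx) (le_max_right _ _)
    · simp only [hus' x hx, neg_zero, max_self, zero_mul, le_refl]
  rw [integral_mul_const] at hWint
  have er : (∫ x, max (-u x) 0) * (weilArchDensity a * ∫ s, max (u s) 0) =
      weilArchDensity a * ((∫ x, max (u x) 0) * ∫ x, max (-u x) 0) := by ring
  have h := hlow
  rw [harch, hval] at h
  linarith

/-! ### Numerics: `0 < a ≤ 11/40 ⇒ 2a < log 2` and `1 + cosh a < ρ(a)` -/

/-- `a ≤ 11/40 ⇒ 2a < log 2` (no prime length enters the window). [folklore] -/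
theorem two_mul_lt_log_two_of_le_evenWindow (ha : a ≤ 11 / 40) : 2 * a < Real.log 2 := by
  have h := Real.log_two_gt_d9
  linarith

/-- **The even kernel inequality, strict (PROVED)**: `0 < a ≤ 11/40 ⇒ 1 + cosh a < ρ(a)`
(`1 + cosh a ≤ 1 + cosh(11/40) ≤ 2.0382 < 2.05 ≤ ρ(11/40) ≤ ρ(a)`; the true threshold of the
inequality is `a = 0.2782…`). [folklore] -/
theorem one_add_cosh_lt_weilArchDensity_of_le (ha0 : 0 < a) (ha : a ≤ 11 / 40) :
    1 + Real.cosh a < weilArchDensity a := by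
  have h1 : Real.cosh a ≤ Real.cosh (11 / 40) := by
    rw [Real.cosh_le_cosh, abs_of_pos ha0, abs_of_pos (by norm_num : (0 : ℝ) < 11 / 40)]
    exact ha
  have h2 : weilArchDensity (11 / 40) ≤ weilArchDensity a :=
    weilArchDensity_antitoneOn (mem_Ioi.2 ha0) (mem_Ioi.2 (by norm_num)) ha
  linarith [et_one_add_cosh_le, et_weilArchDensity_ge]

end EvenKernelTools

end Summit.RiemannHypothesis.RiemannHypothesis.Theorems.PfPersistence

end
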